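import Summits.QuantumFields.YangMills.Theorems.AlphaInputsT3ACv3DataSchemaR
import Summits.QuantumFields.YangMills.Theorems.AlphaInputsT3ACv3DataSchemaLC
import HarnessLib

/-!
# `AlphaInputsT3ACv3CoreNonemptyR` — STRATEGY B for 2′, RE-CUT PART R4: THE UNCHARGED HALF OF (D6R) IS A THEOREM UNDER RECORD SIZES; THE CHARGED HALF (D6R-CHARGED) DISPLAYED;
# THE KNIT AND THE RECORD-PARAMETRIC DISPLAY OF 2′ OVER THE **READ-LOCAL** CLASS — lane `pub-balaban3d`, seat alpha-2 (g3)

WHAT (HOME `D6L-STATUS-alpha2-g3.md` §4).  §1 ★★ `core_nonemptyR_of_collar`: under (N2′) `CollarE (T3Scales …) 𝔠 K` and `4π ≤ C68`, for every `k ≤ K` and every ADMISSIBLE history the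
W-independent core `localSmallT3 ∩ reg68LocalSet ∩ large67Set` of `𝒞_R` contains the enlarged-region profile (this seat's `core_nonempty_of_collar` + `regClassC ⊆ reg68LocalSet`);
★★ `adaptedClassT3R_nonempty_of_not_charged_of_collar` (the UNCHARGED half of (D6R)); (D6R-CHARGED) `AdaptedClassNonemptyChargedT3R` — the displayed residual: for charged
`(h, W)` a finest-lattice field with EXACT `k`-fold `blockAvg ℰp`-averages `W` on the bonds of `Ω_k(h)`, r3's regularity inside `Ω_k(h)` and the `Λ_i(h)`, (67)∕(68) at the
recorded plaquettes, small loop variables on the read cones ([7] Thm 1 WITH DOMAINS ⊕ the profile ⊕ free seams; NOT proved here); ★ `adaptedClassNonemptyT3R_of_charged_of_collar`.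
§2 knits: ★★ `ofV3At_of_pinnedRowsRC` (lane A's PinKnit with `hD6 ↦ (hM₁ : 7L+3 ≤ M₁, hD6RC)` and `hrows` over `AdaptedToT3R`), `dataSchemaT3ACR_of_pinnedRows₂C` ∕ `ofV3At_of_pinnedRows₂RC`
(closed-form sizes + (O″)).  §3 the record-parametric display `PinnedPartsT3ACRecR L` (lane A's `PinnedPartsT3ACRec` with (D6) ↦ (D6R-CHARGED), rows over `𝒞_R`, size `7L+3 ≤ M₁`) and
★★★ `alphaInputsT3ACv3Rec_of_pinnedPartsRecR : PinnedPartsT3ACRecR L → AlphaInputsT3ACv3Rec L` — the registered 2′ text BY NAME.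
HONEST FRAMING.  (T) `Thm1GlobalMinAt`, (D6R-CHARGED) and the data rows (O) over `𝒞_R` stay DISPLAYED; nothing of [B10]∕[7]∕[4]'s estimates asserted; count-neutral helper toward
R3 2′ (`stub_laneRecordsV3`, items 19935∕19936); registry untouched; nothing about d = 4, the continuum, or a mass gap.

References: T. Bałaban, Commun. Math. Phys. 102 (1985) 255–275 [Balaban1985UV3] ((7) p.257, (39)–(42) p.266, (67)–(68) p.273, Thm 2 p.272); CMP 102 (1985) 277–309
[Balaban1985Variational] (Thm 1 (6)–(8) pp.278–279); CMP 98 (1985) 17–51 [Balaban1985Averaging] (Props. 1–2 p.26).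
-/

set_option autoImplicit false

noncomputable section

namespace Summit.QuantumFields.YangMills.Theorems

open MeasureTheory Set
open scoped Matrix.Norms.L2Operator
open Literature.MathematicalPhysics.QuantumFieldTheory.Balaban1983to89
open Literature.MathematicalPhysics.QuantumFieldTheory.Balaban1983to89.T3ContinuumYM3Torus
open Literature.MathematicalPhysics.QuantumFieldTheory.Balaban1983to89.T3UnitScaleTilt (θBal)
open Literature.MathematicalPhysics.QuantumFieldTheory.Balaban1983to89.T3PrintedMinimiserExistence (Thm1GlobalMinAt)
open Literature.MathematicalPhysics.QuantumFieldTheory.Balaban1983to89.T3Thresholds (sqrt_le_exp_iff)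
open Literature.MathematicalPhysics.QuantumFieldTheory.Balaban1983to89.ExpMeanLog (deltaSU)
open Literature.MathematicalPhysics.QuantumFieldTheory.Balaban1985CMP102.Setting
open Summit.QuantumFields.Balaban3D.Carriers
open Summit.QuantumFields.Balaban3D.Proofs.Primitives
open Summit.QuantumFields.Balaban3D.Proofs.Thresholds (Q0 Q0_pos)
open Summit.QuantumFields.YangMills.Theorems.BalabanUVNodesN08AlphaCompactSel (regClassC)
open Summit.QuantumFields.YangMills.Theorems.ProfileEnlarged (CollarE)
open B7Prop2Explicit (C0 C0_pos)

/-! ## §1 The uncharged half of (D6R) under the collar; the charged half displayed -/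

section Charged

variable (F : T3Family) (𝔠 : AlphaConsts F.L (suGroupModel 2).N) (γ : ℝ) (hγ : 0 < γ) (hγ1 : γ ≤ (min 𝔠.gamma0 1) ^ 2)

/-- **(D6R-CHARGED) — THE CHARGED HALF OF THE READ-LOCAL NON-EMPTINESS ROW** (hypothesis schema, kinematic, never asserted; the residual of strategy B after the re-cut): for every
`k ≤ K`, every admissible NON-trivial history `h` and every CHARGED datum `W` (`ChargedT3`: the (40)-window inside `Ω_k(h)`), `𝒞_R(k, h, W)` is non-empty — some finest-lattice field
with EXACT `k`-fold `blockAvg ℰp`-average `W` on the bonds of `Ω_k(h)`, regular intermediate averages on the plaquettes inside `Ω_k(h)` and inside the `Λ_i(h)`, (67)-large and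
(68)-regular at the recorded plaquettes, with small loop variables on the read cones (print's constrained minimiser `U_k(V,h)`: [7] Thm 1 with domains, glued to a large profile across
free seams). [cite: Balaban1985UV3, (40)–(42) p.266 + (67)–(68) p.273; Balaban1985Variational, Thm 1 (8) p.279] -/
def AlphaInputsT3AC.AdaptedClassNonemptyChargedT3R (K : ℕ) : Prop :=
  (∀ (k : ℕ), k ≤ K → ∀ (h : Hist (F.P K) k),
        Hist.Admissible 𝔠.lane.carrier.M₁ (rcolOf (T3Scales F γ hγ (hγ1.trans (sq_min_one_le _ 𝔠.gamma0_pos)) K) 𝔠.lane.carrier) k h →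
        h ≠ Hist.triv (F.P K) k → ∀ (W : GaugeField (F.P K) k (Matrix.specialUnitaryGroup (Fin 2) ℂ)),
          ChargedT3 F γ 𝔠.b₀ 𝔠.p₀ (avgWindowFactor F.L) K 𝔠.lane.carrier.M₁
            (rcolOf (T3Scales F γ hγ (hγ1.trans (sq_min_one_le _ 𝔠.gamma0_pos)) K) 𝔠.lane.carrier) k h W →
          (AlphaInputsT3AC.adaptedClassT3R F 𝔠 γ hγ hγ1 K k h W).Nonempty)

variable {F 𝔠 γ hγ hγ1} {K : ℕ}

/-- (D6R) implies its charged half. [folklore] -/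
theorem AlphaInputsT3AC.adaptedClassNonemptyChargedT3R_of_T3R (h6 : AlphaInputsT3AC.AdaptedClassNonemptyT3R F 𝔠 γ hγ hγ1 K) :
    AlphaInputsT3AC.AdaptedClassNonemptyChargedT3R F 𝔠 γ hγ hγ1 K :=
  fun k hk h hh ht W _ => h6 k hk h hh ht W

/-- **★★ THE W-INDEPENDENT CORE OF THE READ-LOCAL CLASS IS NON-EMPTY** under the collar row (N2′) `CollarE … K` and `4π ≤ C68`: for every `k ≤ K` and every ADMISSIBLE history the
enlarged-region profile lies in `localSmallT3 ∩ reg68LocalSet ∩ large67Set` (`core_nonempty_of_collar` + `regClassC ⊆ reg68LocalSet`).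
[cite: Balaban1985UV3, (39)–(42) p.266 + (67)–(68) p.273; Balaban1985Variational, (2)+(8) pp.278–279] -/
theorem AlphaInputsT3AC.core_nonemptyR_of_collar (hN2 : CollarE (T3Scales F γ hγ (hγ1.trans (sq_min_one_le _ 𝔠.gamma0_pos)) K) 𝔠 K) (hC : 4 * Real.pi ≤ 𝔠.C68)
    {k : ℕ} (hk : k ≤ K) {h : Hist (F.P K) k}
    (hh : Hist.Admissible 𝔠.lane.carrier.M₁ (rcolOf (T3Scales F γ hγ (hγ1.trans (sq_min_one_le _ 𝔠.gamma0_pos)) K) 𝔠.lane.carrier) k h) :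
    (AlphaInputsT3AC.localSmallT3 F 𝔠 γ hγ hγ1 K k h ∩
      (AlphaInputsT3AC.reg68LocalSet F 𝔠 γ hγ hγ1 K k h ∩ AlphaInputsT3AC.large67Set F 𝔠 γ hγ hγ1 K k h)).Nonempty := by
  obtain ⟨U, hloc, hreg, hL⟩ := AlphaInputsT3AC.core_nonempty_of_collar hN2 hC hk hh
  exact ⟨U, hloc, AlphaInputsT3AC.regClassC_subset_reg68LocalSet (𝔠 := 𝔠) (hγ1 := hγ1) hk hh hreg, hL⟩

/-- **★★ THE UNCHARGED HALF OF (D6R) UNDER THE TWO CONSTANTS SIDE CONDITIONS**: under `CollarE … K` and `4π ≤ C68`, for every `k ≤ K`, every admissible `h` and every datum `W`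
that is NOT charged, `𝒞_R(k, h, W)` is non-empty. [cite: Balaban1985UV3, (40)–(42) p.266 + (67)–(68) p.273] -/
theorem AlphaInputsT3AC.adaptedClassT3R_nonempty_of_not_charged_of_collar
    (hN2 : CollarE (T3Scales F γ hγ (hγ1.trans (sq_min_one_le _ 𝔠.gamma0_pos)) K) 𝔠 K) (hC : 4 * Real.pi ≤ 𝔠.C68)
    {k : ℕ} (hk : k ≤ K) {h : Hist (F.P K) k}
    (hh : Hist.Admissible 𝔠.lane.carrier.M₁ (rcolOf (T3Scales F γ hγ (hγ1.trans (sq_min_one_le _ 𝔠.gamma0_pos)) K) 𝔠.lane.carrier) k h)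
    (W : GaugeField (F.P K) k (Matrix.specialUnitaryGroup (Fin 2) ℂ))
    (hW : ¬ ChargedT3 F γ 𝔠.b₀ 𝔠.p₀ (avgWindowFactor F.L) K 𝔠.lane.carrier.M₁
      (rcolOf (T3Scales F γ hγ (hγ1.trans (sq_min_one_le _ 𝔠.gamma0_pos)) K) 𝔠.lane.carrier) k h W) :
    (AlphaInputsT3AC.adaptedClassT3R F 𝔠 γ hγ hγ1 K k h W).Nonempty := by
  obtain ⟨U, hloc, hreg, hL⟩ := AlphaInputsT3AC.core_nonemptyR_of_collar hN2 hC hk hh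
  exact ⟨U, hloc, hreg, hL, fun hc => absurd hc hW⟩

/-- **★ (D6R) FROM ITS CHARGED HALF, THE COLLAR ROW (N2′) AND `4π ≤ C68`.** [cite: Balaban1985UV3, (40)–(42) p.266 + (67)–(68) p.273] -/
theorem AlphaInputsT3AC.adaptedClassNonemptyT3R_of_charged_of_collar
    (hN2 : CollarE (T3Scales F γ hγ (hγ1.trans (sq_min_one_le _ 𝔠.gamma0_pos)) K) 𝔠 K) (hC : 4 * Real.pi ≤ 𝔠.C68)
    (h6 : AlphaInputsT3AC.AdaptedClassNonemptyChargedT3R F 𝔠 γ hγ hγ1 K) : AlphaInputsT3AC.AdaptedClassNonemptyT3R F 𝔠 γ hγ hγ1 K := by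
  intro k hk h hh ht W
  by_cases hW : ChargedT3 F γ 𝔠.b₀ 𝔠.p₀ (avgWindowFactor F.L) K 𝔠.lane.carrier.M₁
      (rcolOf (T3Scales F γ hγ (hγ1.trans (sq_min_one_le _ 𝔠.gamma0_pos)) K) 𝔠.lane.carrier) k h W
  · exact h6 k hk h hh ht W hW
  · exact AlphaInputsT3AC.adaptedClassT3R_nonempty_of_not_charged_of_collar hN2 hC hk hh W hW

end Charged

/-! ## §2 The knit over the read-local class with (D6R) replaced by `7L + 3 ≤ M₁` and its charged half -/

section Knit

variable (F : T3Family) (𝔠 : AlphaConsts F.L (suGroupModel 2).N)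

/-- ★★ **THE v3 (α) PACKAGE FROM [7] THM 1 + SIZE CONDITIONS (incl. `7L + 3 ≤ M₁`) + (D6R-CHARGED) + THE DATA ROWS (O∀) OVER `𝒞_R`** — `ofV3At_of_pinnedRowsR` with `hD6R` supplied by
`adaptedClassNonemptyT3R_of_charged_of_collar` ((N2′) ⇐ `collarE_T3_of_M₁_ge`, `4π ≤ C68` ⇐ `four_pi_le_C68_of_sizes`).
[cite: Balaban1985UV3, Thm 2 p.272 + (40)–(42) p.266 + (67)–(68) p.273; Balaban1985Variational, Thm 1 (8) p.279] -/
theorem AlphaInputsT3AC.ofV3At_of_pinnedRowsRC {a₀ a₁ : ℝ}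
    (hT : Thm1GlobalMinAt F.L a₀ a₁ 𝔠.B₃) (hwin : 𝔠.B₃ * a₁ ≤ a₀)
    (hA3 : (143 * ((((3 + 4 : ℕ) : ℝ)) ^ 2 / 4) ^ 2) * (2 * (𝔠.B₃ * a₁)) ≤ 1 / 3)
    (hA2 : 2 * (2 * (𝔠.B₃ * a₁)) ≤ 2 * deltaSU (Fin 2) / (((3 + 4) * F.L : ℕ) : ℝ) ^ 2)
    (hB₃ : 1 ≤ 2 * 𝔠.B₃) (hC : 4 * 𝔠.B₃ * (F.L : ℝ) ^ 2 * avgWindowFactor F.L ≤ 𝔠.C68)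
    (hanti : (min 𝔠.gamma0 1) ^ 2 ≤ Real.exp (2 * (1 - 𝔠.p₀)))
    (hsmall : ∀ γ : ℝ, 0 < γ → γ ≤ (min 𝔠.gamma0 1) ^ 2 →
      ∀ K k : ℕ, 2 * (F.L : ℝ) ^ 2 * avgWindowFactor F.L * θBal F.L γ 𝔠.b₀ 𝔠.p₀ (K - k + 1) ≤ a₁)
    (hM₁ : 7 * F.L + 3 ≤ 𝔠.M₁)
    (hD6RC : ∀ (γ : ℝ) (hγ : 0 < γ) (hγ1 : γ ≤ (min 𝔠.gamma0 1) ^ 2) (K : ℕ), AlphaInputsT3AC.AdaptedClassNonemptyChargedT3R F 𝔠 γ hγ hγ1 K)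
    (hrows : ∀ (γ : ℝ) (hγ : 0 < γ) (hγ1 : γ ≤ (min 𝔠.gamma0 1) ^ 2) (K : ℕ)
      (Ut : (k : ℕ) → GaugeField (F.P K) k (Matrix.specialUnitaryGroup (Fin 2) ℂ) → GaugeField (F.P K) 0 (Matrix.specialUnitaryGroup (Fin 2) ℂ)),
      AlphaInputsT3AC.TrivMinimiserRowsT3 F 𝔠 γ hγ hγ1 a₀ a₁ K Ut → AlphaInputsT3AC.DataRowsT3R F 𝔠 γ hγ hγ1 K Ut) :
    AlphaInputsT3AC.OfV3At F 𝔠 a₀ a₁ :=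
  AlphaInputsT3AC.ofV3At_of_pinnedRowsR F 𝔠 hT hwin hA3 hA2 hB₃ hC hanti hsmall
    (fun γ hγ hγ1 K => AlphaInputsT3AC.adaptedClassNonemptyT3R_of_charged_of_collar
      (AlphaInputsT3AC.collarE_T3_of_M₁_ge (hγ := hγ) (hγ1 := hγ1) (K := K) hM₁)
      (AlphaInputsT3AC.four_pi_le_C68_of_sizes (𝔠 := 𝔠) hB₃ hC) (hD6RC γ hγ hγ1 K))
    hrows

/-- ★★ **THE READ-LOCAL SCHEMA FROM [7] THEOREM 1, (D6R-CHARGED), THE PRINT-STRENGTH DATA ROW (O″), AND SIZES IN CLOSED FORM (incl. `7L + 3 ≤ M₁`)** — lane A's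
`dataSchemaT3AC_of_pinnedRows₂` over `𝒞_R`. [cite: Balaban1985Variational, Thm 1 (6)–(8) pp.278–279; Balaban1985UV3, (40)–(42) p.266, (68) p.273 and Thm 2 p.272] -/
theorem AlphaInputsT3AC.dataSchemaT3ACR_of_pinnedRows₂C {a₀ a₁ : ℝ}
    (hT : Thm1GlobalMinAt F.L a₀ a₁ 𝔠.B₃) (ha₁ : 0 < a₁) (hwin : 𝔠.B₃ * a₁ ≤ a₀)
    (hA3 : (143 * ((((3 + 4 : ℕ) : ℝ)) ^ 2 / 4) ^ 2) * (2 * (𝔠.B₃ * a₁)) ≤ 1 / 3)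
    (hA2 : 2 * (2 * (𝔠.B₃ * a₁)) ≤ 2 * deltaSU (Fin 2) / (((3 + 4) * F.L : ℕ) : ℝ) ^ 2)
    (hB₃ : 1 ≤ 2 * 𝔠.B₃) (hC : 4 * 𝔠.B₃ * (F.L : ℝ) ^ 2 * avgWindowFactor F.L ≤ 𝔠.C68)
    (hCe : Real.exp (𝔠.p₀ - 1) ≤ 3 * C0 3 * 𝔠.C68 * (𝔠.b₀ * Q0 𝔠.p₀))
    (hCa : (𝔠.b₀ * Q0 𝔠.p₀) * (2 * (F.L : ℝ) ^ 2 * avgWindowFactor F.L) ^ 2 ≤ 3 * C0 3 * 𝔠.C68 * a₁ ^ 2)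
    (hM₁ : 7 * F.L + 3 ≤ 𝔠.M₁)
    (hD6RC : ∀ (γ : ℝ) (hγ : 0 < γ) (hγ1 : γ ≤ (min 𝔠.gamma0 1) ^ 2) (K : ℕ), AlphaInputsT3AC.AdaptedClassNonemptyChargedT3R F 𝔠 γ hγ hγ1 K)
    (hrows : ∀ (γ : ℝ) (hγ : 0 < γ) (hγ1 : γ ≤ (min 𝔠.gamma0 1) ^ 2) (K : ℕ),
      (∃ Ut : (k : ℕ) → GaugeField (F.P K) k (Matrix.specialUnitaryGroup (Fin 2) ℂ) → GaugeField (F.P K) 0 (Matrix.specialUnitaryGroup (Fin 2) ℂ),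
        AlphaInputsT3AC.TrivMinimiserRowsT3 F 𝔠 γ hγ hγ1 a₀ a₁ K Ut) →
      ∃ Ut : (k : ℕ) → GaugeField (F.P K) k (Matrix.specialUnitaryGroup (Fin 2) ℂ) → GaugeField (F.P K) 0 (Matrix.specialUnitaryGroup (Fin 2) ℂ),
        AlphaInputsT3AC.TrivMinimiserRowsT3 F 𝔠 γ hγ hγ1 a₀ a₁ K Ut ∧ AlphaInputsT3AC.DataRowsT3R F 𝔠 γ hγ hγ1 K Ut) :
    DataSchemaT3ACR F 𝔠 a₀ a₁ := by
  have hL1 : 1 ≤ F.L := by have := F.hL.2; omega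
  have hanti := MinimiserPin.anti_of_C68 𝔠 hCe
  have hsmall := MinimiserPin.small_of_C68 𝔠 hL1 ha₁ (avgWindowFactor_pos F) hCa
  have hπ : 4 * Real.pi ≤ 𝔠.C68 := AlphaInputsT3AC.four_pi_le_C68_of_sizes (𝔠 := 𝔠) hB₃ hC
  intro γ hγ hγ1 K
  have hγ1' : γ ≤ 1 := hγ1.trans (sq_min_one_le _ 𝔠.gamma0_pos)
  have hγe : Real.sqrt γ ≤ Real.exp (1 - 𝔠.p₀) := (sqrt_le_exp_iff hγ.le).mpr (hγ1.trans hanti)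
  have hw0 : 0 ≤ (F.L : ℝ) ^ 2 * avgWindowFactor F.L := by
    have := avgWindowFactor_pos F
    positivity
  have hC2 : 2 * (F.L : ℝ) ^ 2 * avgWindowFactor F.L ≤ 𝔠.C68 := by nlinarith
  refine ⟨MinimiserPin.windowIneqT3_of_le F 𝔠 hγ hγ1' hγe hC2 K,
    AlphaInputsT3AC.adaptedClassNonemptyT3R_of_charged_of_collar (AlphaInputsT3AC.collarE_T3_of_M₁_ge (hγ := hγ) (hγ1 := hγ1) (K := K) hM₁) hπ (hD6RC γ hγ hγ1 K),
    hrows γ hγ hγ1 K ?_⟩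
  exact AlphaInputsT3AC.trivMinimiserRowsT3_of_thm1GlobalMinAt F 𝔠 γ hγ hγ1 K hT hwin hA3 hA2 hB₃
    (fun k _ => hsmall γ hγ hγ1 K k)
    (fun k i hik hkK => MinimiserPin.C68_dom_of_le hL1 hγ hγ1' hγe 𝔠.b₀_pos 𝔠.p₀_pos.le (avgWindowFactor_pos F).le
      𝔠.B₃_pos.le hC K k i hik hkK)

/-- ★★ **THE v3 (α) PACKAGE FROM THE SAME** (through `ofV3At_of_dataSchemaT3R`). [cite: Balaban1985UV3, Thm 2 p.272; Balaban1985Variational, Thm 1 (8) p.279] -/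
theorem AlphaInputsT3AC.ofV3At_of_pinnedRows₂RC {a₀ a₁ : ℝ}
    (hT : Thm1GlobalMinAt F.L a₀ a₁ 𝔠.B₃) (ha₁ : 0 < a₁) (hwin : 𝔠.B₃ * a₁ ≤ a₀)
    (hA3 : (143 * ((((3 + 4 : ℕ) : ℝ)) ^ 2 / 4) ^ 2) * (2 * (𝔠.B₃ * a₁)) ≤ 1 / 3)
    (hA2 : 2 * (2 * (𝔠.B₃ * a₁)) ≤ 2 * deltaSU (Fin 2) / (((3 + 4) * F.L : ℕ) : ℝ) ^ 2)
    (hB₃ : 1 ≤ 2 * 𝔠.B₃) (hC : 4 * 𝔠.B₃ * (F.L : ℝ) ^ 2 * avgWindowFactor F.L ≤ 𝔠.C68)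
    (hCe : Real.exp (𝔠.p₀ - 1) ≤ 3 * C0 3 * 𝔠.C68 * (𝔠.b₀ * Q0 𝔠.p₀))
    (hCa : (𝔠.b₀ * Q0 𝔠.p₀) * (2 * (F.L : ℝ) ^ 2 * avgWindowFactor F.L) ^ 2 ≤ 3 * C0 3 * 𝔠.C68 * a₁ ^ 2)
    (hM₁ : 7 * F.L + 3 ≤ 𝔠.M₁)
    (hD6RC : ∀ (γ : ℝ) (hγ : 0 < γ) (hγ1 : γ ≤ (min 𝔠.gamma0 1) ^ 2) (K : ℕ), AlphaInputsT3AC.AdaptedClassNonemptyChargedT3R F 𝔠 γ hγ hγ1 K)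
    (hrows : ∀ (γ : ℝ) (hγ : 0 < γ) (hγ1 : γ ≤ (min 𝔠.gamma0 1) ^ 2) (K : ℕ),
      (∃ Ut : (k : ℕ) → GaugeField (F.P K) k (Matrix.specialUnitaryGroup (Fin 2) ℂ) → GaugeField (F.P K) 0 (Matrix.specialUnitaryGroup (Fin 2) ℂ),
        AlphaInputsT3AC.TrivMinimiserRowsT3 F 𝔠 γ hγ hγ1 a₀ a₁ K Ut) →
      ∃ Ut : (k : ℕ) → GaugeField (F.P K) k (Matrix.specialUnitaryGroup (Fin 2) ℂ) → GaugeField (F.P K) 0 (Matrix.specialUnitaryGroup (Fin 2) ℂ),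
        AlphaInputsT3AC.TrivMinimiserRowsT3 F 𝔠 γ hγ hγ1 a₀ a₁ K Ut ∧ AlphaInputsT3AC.DataRowsT3R F 𝔠 γ hγ hγ1 K Ut) :
    AlphaInputsT3AC.OfV3At F 𝔠 a₀ a₁ :=
  AlphaInputsT3AC.ofV3At_of_dataSchemaT3R
    (AlphaInputsT3AC.dataSchemaT3ACR_of_pinnedRows₂C F 𝔠 hT ha₁ hwin hA3 hA2 hB₃ hC hCe hCa hM₁ hD6RC hrows)

end Knit

/-! ## §3 The record-parametric display of 2′ over the read-local class, and the registered text from it -/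

section Record

/-- **2′ DISPLAYED OVER THE READ-LOCAL CLASS** — lane A's `AlphaInputsT3AC.PinnedPartsT3ACRec` with the kinematic row (D6) replaced by (D6R-CHARGED), the data row (O″) over
`𝒞_R`, and the extra size `7L + 3 ≤ M₁` (which, with `1 ≤ 2B₃` and `4B₃L²·avgWindowFactor ≤ C68`, discharges the uncharged half of (D6R)).
[cite: Balaban1985UV3, (7) p.257, (40)–(42) p.266, (68) p.273 and Thm 2 p.272; Balaban1985Variational, Thm 1 (6)–(8) pp.278–279; Balaban1985Averaging, Prop. 2 p.22] -/
def AlphaInputsT3AC.PinnedPartsT3ACRecR (L : ℕ) : Prop :=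
  ∃ (b₁ p₁ : ℝ), ∀ (b₀ p₀ : ℝ), b₁ ≤ b₀ → p₁ ≤ p₀ →
    ∃ (𝔠 : AlphaConsts L (suGroupModel 2).N) (a₀ a₁ : ℝ), 𝔠.b₀ = b₀ ∧ 𝔠.p₀ = p₀ ∧ 0 < a₀ ∧ 0 < a₁ ∧ 𝔠.B₃ * a₁ ≤ a₀ ∧
      (143 * ((((3 + 4 : ℕ) : ℝ)) ^ 2 / 4) ^ 2) * (2 * (𝔠.B₃ * a₁)) ≤ 1 / 3 ∧
      2 * (2 * (𝔠.B₃ * a₁)) ≤ 2 * deltaSU (Fin 2) / (((3 + 4) * L : ℕ) : ℝ) ^ 2 ∧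
      1 ≤ 2 * 𝔠.B₃ ∧ 4 * 𝔠.B₃ * (L : ℝ) ^ 2 * avgWindowFactor L ≤ 𝔠.C68 ∧
      Real.exp (𝔠.p₀ - 1) ≤ 3 * C0 3 * 𝔠.C68 * (𝔠.b₀ * Q0 𝔠.p₀) ∧
      (𝔠.b₀ * Q0 𝔠.p₀) * (2 * (L : ℝ) ^ 2 * avgWindowFactor L) ^ 2 ≤ 3 * C0 3 * 𝔠.C68 * a₁ ^ 2 ∧
      7 * L + 3 ≤ 𝔠.M₁ ∧
      Thm1GlobalMinAt L a₀ a₁ 𝔠.B₃ ∧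
      ∀ (F : T3Family) (hF : F.L = L),
        (∀ (γ : ℝ) (hγ : 0 < γ) (hγ1 : γ ≤ (min (hF ▸ 𝔠).gamma0 1) ^ 2) (K : ℕ),
          AlphaInputsT3AC.AdaptedClassNonemptyChargedT3R F (hF ▸ 𝔠) γ hγ hγ1 K) ∧
        (∀ (γ : ℝ) (hγ : 0 < γ) (hγ1 : γ ≤ (min (hF ▸ 𝔠).gamma0 1) ^ 2) (K : ℕ),
          (∃ Ut : (k : ℕ) → GaugeField (F.P K) k (Matrix.specialUnitaryGroup (Fin 2) ℂ) → GaugeField (F.P K) 0 (Matrix.specialUnitaryGroup (Fin 2) ℂ),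
            AlphaInputsT3AC.TrivMinimiserRowsT3 F (hF ▸ 𝔠) γ hγ hγ1 a₀ a₁ K Ut) →
          ∃ Ut : (k : ℕ) → GaugeField (F.P K) k (Matrix.specialUnitaryGroup (Fin 2) ℂ) → GaugeField (F.P K) 0 (Matrix.specialUnitaryGroup (Fin 2) ℂ),
            AlphaInputsT3AC.TrivMinimiserRowsT3 F (hF ▸ 𝔠) γ hγ hγ1 a₀ a₁ K Ut ∧ AlphaInputsT3AC.DataRowsT3R F (hF ▸ 𝔠) γ hγ hγ1 K Ut)

/-- At a family of block size `L` the body of `PinnedPartsT3ACRecR` gives `OfV3At` (§2 after transport along `hF`). [cite: Balaban1985UV3, Thm 2 p.272; Balaban1985Variational, Thm 1 (8) p.279] -/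
theorem AlphaInputsT3AC.ofV3At_of_pinnedPartsR_cast {L : ℕ} {𝔠 : AlphaConsts L (suGroupModel 2).N} {a₀ a₁ : ℝ}
    (ha₁ : 0 < a₁) (hwin : 𝔠.B₃ * a₁ ≤ a₀)
    (hA3 : (143 * ((((3 + 4 : ℕ) : ℝ)) ^ 2 / 4) ^ 2) * (2 * (𝔠.B₃ * a₁)) ≤ 1 / 3)
    (hA2 : 2 * (2 * (𝔠.B₃ * a₁)) ≤ 2 * deltaSU (Fin 2) / (((3 + 4) * L : ℕ) : ℝ) ^ 2)
    (hB₃ : 1 ≤ 2 * 𝔠.B₃) (hC : 4 * 𝔠.B₃ * (L : ℝ) ^ 2 * avgWindowFactor L ≤ 𝔠.C68)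
    (hCe : Real.exp (𝔠.p₀ - 1) ≤ 3 * C0 3 * 𝔠.C68 * (𝔠.b₀ * Q0 𝔠.p₀))
    (hCa : (𝔠.b₀ * Q0 𝔠.p₀) * (2 * (L : ℝ) ^ 2 * avgWindowFactor L) ^ 2 ≤ 3 * C0 3 * 𝔠.C68 * a₁ ^ 2)
    (hM₁ : 7 * L + 3 ≤ 𝔠.M₁)
    (hT : Thm1GlobalMinAt L a₀ a₁ 𝔠.B₃) (F : T3Family) (hF : F.L = L)
    (hD6RC : ∀ (γ : ℝ) (hγ : 0 < γ) (hγ1 : γ ≤ (min (hF ▸ 𝔠).gamma0 1) ^ 2) (K : ℕ),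
      AlphaInputsT3AC.AdaptedClassNonemptyChargedT3R F (hF ▸ 𝔠) γ hγ hγ1 K)
    (hrows : ∀ (γ : ℝ) (hγ : 0 < γ) (hγ1 : γ ≤ (min (hF ▸ 𝔠).gamma0 1) ^ 2) (K : ℕ),
      (∃ Ut : (k : ℕ) → GaugeField (F.P K) k (Matrix.specialUnitaryGroup (Fin 2) ℂ) → GaugeField (F.P K) 0 (Matrix.specialUnitaryGroup (Fin 2) ℂ),
        AlphaInputsT3AC.TrivMinimiserRowsT3 F (hF ▸ 𝔠) γ hγ hγ1 a₀ a₁ K Ut) →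
      ∃ Ut : (k : ℕ) → GaugeField (F.P K) k (Matrix.specialUnitaryGroup (Fin 2) ℂ) → GaugeField (F.P K) 0 (Matrix.specialUnitaryGroup (Fin 2) ℂ),
        AlphaInputsT3AC.TrivMinimiserRowsT3 F (hF ▸ 𝔠) γ hγ hγ1 a₀ a₁ K Ut ∧ AlphaInputsT3AC.DataRowsT3R F (hF ▸ 𝔠) γ hγ hγ1 K Ut) :
    AlphaInputsT3AC.OfV3At F (hF ▸ 𝔠) a₀ a₁ := by
  subst hF
  exact AlphaInputsT3AC.ofV3At_of_pinnedRows₂RC F 𝔠 hT ha₁ hwin hA3 hA2 hB₃ hC hCe hCa hM₁ hD6RC hrows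

/-- ★★★ **THE REGISTERED 2′ TEXT FROM ITS READ-LOCAL DISPLAY**: `PinnedPartsT3ACRecR L → AlphaInputsT3ACv3Rec L` — 2′ `stub_laneRecordsV3` re-cut to «(T) [7] Thm 1 + (D6R-CHARGED) +
(O″) the data rows over `𝒞_R`, at a record with exact profile, small `a₁`, `C68 ≥ c_min` and `M₁ ≥ 7L + 3`». [cite: Balaban1985UV3, Thm 2 p.272; Balaban1985Variational, Thm 1 (8) p.279] -/
theorem alphaInputsT3ACv3Rec_of_pinnedPartsRecR {L : ℕ} (h : AlphaInputsT3AC.PinnedPartsT3ACRecR L) : AlphaInputsT3ACv3Rec L := by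
  obtain ⟨b₁, p₁, h⟩ := h
  refine ⟨b₁, p₁, fun b₀ p₀ hb hp => ?_⟩
  obtain ⟨𝔠, a₀, a₁, h1, h2, h3, h4, h5, hA3, hA2, hB₃, hC, hCe, hCa, hM₁, hT, hD⟩ := h b₀ p₀ hb hp
  exact ⟨𝔠, a₀, a₁, h1, h2, h3, h4, h5, fun F hF =>
    AlphaInputsT3AC.ofV3At_of_pinnedPartsR_cast h4 h5 hA3 hA2 hB₃ hC hCe hCa hM₁ hT F hF (hD F hF).1 (hD F hF).2⟩

end Record

end Summit.QuantumFields.YangMills.Theorems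

end
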